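import Summits.QuantumFields.YangMills.Theorems.LuscherReductionTwistedTraceScalingBTOffDiagonalRatio
import HarnessLib

/-!
# TRANSPORT TO THE CENTRAL FIBRE: `K(oT u v, g·oT u' v') = [K₁(u,u')/K₁(1,1)]·K(oT 1 v, g·oT 1 v')·e^{offX + diagX}` EXACTLY, and the two-sided transport of the
# colour-localised one-sided fibre transfer `fpFibreTransfer` (lane A of S-BASE, crux `TwistedTraceScaling` stmt-QuantumFields-20203, C4-CORE, the (OD) pen;
# design note `pub/ym-fleet/ym-luscher-20007-p1/COARSE-DESIGN.md` §27)

The (B-OD) door in `L²(w)` (`…BODefect.hOD_of_defect`) asks for the transfer `K̃(φ⊗Ω)` of a BO function to be `(ψ⊗Ω)·w + E·w` with `∫E²w` small.  After the Faddeev–Popov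
colour localisation (`…BTColourFP.avgKernel_fp`) the `v`-integral of `K̃(U', oT u v)Ω(v̂)` becomes a colour average of the COLOUR-LOCALISED ONE-SIDED FIBRE TRANSFER
`fpFibreTransfer β Ω W U' u = ∫ W(g)·K_β(U', (orthoTube u v)^g)·Ω(v̂) d(π⊗dg)(v,g)` (this file, §2; one integral over `V × G`).  Its dependence on the slow data is EXACTLY
the one-site kernel, pointwise in the integration variables:
* §1 ★★ `transferKernel_orthoTube_transport` — `K_β(oT u v, (oT u' v')^g) = [K₁^{(L³β)}(u,u')/K₁^{(L³β)}(1,1)]·K_β(oT 1 v, (oT 1 v')^g)·exp(offX β u u' v v' g + diagX β u v v' g)`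
  for ALL `u u' v v' g` (the (L2) identity `transferKernel_orthoTube_offdiag_div` composed with the (L3) identity `transferKernel_orthoTube_diag_div_one_site`);
* §2 `fpFibreTransfer` (def), `measurable_fpFibreTransfer_integrand`, `fpFibreTransfer_nonneg`;
* §3 ★★★ `fpFibreTransfer_two_sided` — if `|offX β u' u v' v g + diagX β u' v' v g| ≤ η` on `supp Ω × supp W` (the output point `oT u' v'` fixed), `Ω, W ≥ 0`, then
  `e^{−η}·ρ·T₁ ≤ fpFibreTransfer β Ω W (oT u' v') u ≤ e^{η}·ρ·T₁`, `ρ = K₁(u',u)/K₁(1,1)`, `T₁ = fpFibreTransfer β Ω W (oT 1 v') 1` (the CENTRAL transfer): positivity turns the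
  pointwise sandwich into an integral sandwich — no Gaussian is evaluated here.
SIZES (from `abs_offX_le`, `abs_diagX_sub_diagX1_le`, `abs_diagX1_le` on the schedule-B cores `|v|,|v'| ≤ β^{-1/2}ℓ`, based gauge core `‖g_x − 1‖ ≤ β^{-1/2}ℓ`, near pairs
`|u − u'| ≤ β^{-1/2}ℓ²`, slow window `|u − 1| ≤ Kβ^{-s}`): `η = O(β^{-s}ℓ² + β^{-1/2}ℓ⁴)` — `o(β^{-1/6})` iff `s > 1/6` (the first-order colour term of `diagX1`, which (B-T) had
to average away, is affordable for (B-OD)).  What remains for (B-OD) after this file: the CENTRAL QUASIMODE `T₁(v') ≈ c·e^{−q(x')}` (one Laplace–Gauss evaluation at the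
identity background, or a Perron–Frobenius profile), the colour assembly `Z·Φ = ∫_c fpFibreTransfer(c⁻¹U'c, u) dc`, and the tails — COARSE-DESIGN §27.
HONEST FRAMING: exact algebra + one monotonicity step for a stub of a child of the CONDITIONAL route R2b1; (B-OD), (B-ST) OPEN; C4-CORE OPEN; not infinite volume, not a gap,
not Clay.
-/

set_option autoImplicit false

noncomputable section

open MeasureTheory Filter Topology Real
open scoped BigOperators
open Literature.MathematicalPhysics.QuantumFieldTheory
open Literature.MathematicalPhysics.QuantumLattice

namespace Summit.QuantumFields.YangMills.Theorems.FemtoTransferGap.TwoLattice.ConstTube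

open Summit.QuantumFields.YangMills.Theorems.FemtoTransferGap
open Summit.QuantumFields.YangMills.Theorems.FemtoTransferGap.TwoLattice
open Summit.QuantumFields.YangMills.Theorems.FemtoTransferGap.TwoLattice.Avg
open Summit.QuantumFields.YangMills.Theorems.FemtoTransferGap.TwoLattice.Stiff (LinkSpace)

variable {L : ℕ} [NeZero L]

/-! ## §1 ★★ The exact transport identity -/

/-- ★★ **TRANSPORT TO THE CENTRAL FIBRE (exact).**  For all slow data `u, u'`, fibre data `v, v'` and gauge fields `g`:
`K_β(oT u v, (oT u' v')^g) = [K₁^{(L³β)}(u,u') / K₁^{(L³β)}(1,1)] · K_β(oT 1 v, (oT 1 v')^g) · exp(offX β u u' v v' g + diagX β u v v' g)`. [cite: Luscher1983, §3] -/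
theorem transferKernel_orthoTube_transport (β : ℝ) (u u' : GaugeConfig 3 1 SU2) (v v' : Edge 3 L → Fin 3 → ℝ) (g : Site 3 L → SU2) :
    transferKernel su2Rep β (orthoTube L u v) (gaugeTransform g (orthoTube L u' v')) =
      transferKernel su2Rep ((L : ℝ) ^ 3 * β) u u' / transferKernel su2Rep ((L : ℝ) ^ 3 * β) (1 : GaugeConfig 3 1 SU2) 1 *
        transferKernel su2Rep β (orthoTube L 1 v) (gaugeTransform g (orthoTube L 1 v')) * Real.exp (offX L β u u' v v' g + diagX L β u v v' g) := by
  have hK0 : 0 < transferKernel su2Rep ((L : ℝ) ^ 3 * β) u u' := transferKernel_pos _ _ _ _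
  have hK1 : 0 < transferKernel su2Rep ((L : ℝ) ^ 3 * β) (1 : GaugeConfig 3 1 SU2) 1 := transferKernel_pos _ _ _ _
  have h1 := transferKernel_orthoTube_offdiag_div (L := L) β u u' v v' g
  rw [transferKernel_orthoTube_diag_div_one_site (L := L) β u v v' g] at h1
  rw [div_eq_iff hK0.ne'] at h1
  rw [h1, Real.exp_add]
  field_simp

/-! ## §2 The colour-localised one-sided fibre transfer -/

variable (L) in
/-- **The colour-localised one-sided fibre transfer** `fpFibreTransfer β Ω W U u = ∫ W(g)·K_β(U, (orthoTube u v)^g)·Ω(v̂) d(π ⊗ dg)(v, g)` — the profile `Ω`, sitting in the fibre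
over the slow point `u`, transferred by the kernel with the gauge orbit integral restricted by the Faddeev–Popov weight `W`, evaluated at the configuration `U`.
[cite: Luscher1983, §3] -/
def fpFibreTransfer (β : ℝ) (Ω : LinkSpace L → ℝ) (W : (Site 3 L → SU2) → ℝ) (U : GaugeConfig 3 L SU2) (u : GaugeConfig 3 1 SU2) : ℝ :=
  ∫ p : (Edge 3 L → Fin 3 → ℝ) × (Site 3 L → SU2), W p.2 * transferKernel su2Rep β U (gaugeTransform p.2 (orthoTube L u p.1)) * Ω (linkEmbed L p.1)
    ∂(orthoTransverse L).prod (gaugeMeasure L)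

/-- The integrand of `fpFibreTransfer` is jointly measurable in `(v, g)`. [folklore] -/
theorem measurable_fpFibreTransfer_integrand (β : ℝ) {Ω : LinkSpace L → ℝ} (hΩ : Measurable Ω) {W : (Site 3 L → SU2) → ℝ} (hW : Measurable W)
    (U : GaugeConfig 3 L SU2) (u : GaugeConfig 3 1 SU2) :
    Measurable fun p : (Edge 3 L → Fin 3 → ℝ) × (Site 3 L → SU2) => W p.2 * transferKernel su2Rep β U (gaugeTransform p.2 (orthoTube L u p.1)) * Ω (linkEmbed L p.1) := by
  haveI : SecondCountableTopology SU2 := secondCountableTopology_su2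
  have hK : Measurable fun q : GaugeConfig 3 L SU2 × GaugeConfig 3 L SU2 => transferKernel su2Rep β q.1 q.2 :=
    (continuous_transferKernel su2Rep continuous_su2Rep β).measurable
  have h2 : Measurable fun p : (Edge 3 L → Fin 3 → ℝ) × (Site 3 L → SU2) => gaugeTransform p.2 (orthoTube L u p.1) := by
    have ha : Measurable fun p : (Edge 3 L → Fin 3 → ℝ) × (Site 3 L → SU2) => (orthoTube L u p.1, p.2) :=
      ((measurable_orthoTube_right (L := L) u).comp measurable_fst).prodMk measurable_snd
    have h := (measurable_gaugeAction (L := L)).comp ha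
    simpa only [Function.comp_def] using h
  have hK' : Measurable fun p : (Edge 3 L → Fin 3 → ℝ) × (Site 3 L → SU2) => transferKernel su2Rep β U (gaugeTransform p.2 (orthoTube L u p.1)) := by
    have hc : Measurable fun _ : (Edge 3 L → Fin 3 → ℝ) × (Site 3 L → SU2) => U := measurable_const
    have h := hK.comp (hc.prodMk h2); simpa only [Function.comp_def] using h
  exact ((hW.comp measurable_snd).mul hK').mul (hΩ.comp ((measurable_linkEmbed L).comp measurable_fst))

/-- The integrand of `fpFibreTransfer` is bounded. [folklore] -/
theorem abs_fpFibreTransfer_integrand_le (β : ℝ) {Ω : LinkSpace L → ℝ} {CΩ : ℝ} (hCΩ : ∀ x, |Ω x| ≤ CΩ) {W : (Site 3 L → SU2) → ℝ} {CW : ℝ} (hCW : ∀ g, |W g| ≤ CW)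
    (U : GaugeConfig 3 L SU2) (u : GaugeConfig 3 1 SU2) :
    ∃ B : ℝ, ∀ p : (Edge 3 L → Fin 3 → ℝ) × (Site 3 L → SU2), |W p.2 * transferKernel su2Rep β U (gaugeTransform p.2 (orthoTube L u p.1)) * Ω (linkEmbed L p.1)| ≤ B := by
  obtain ⟨M, hM⟩ := exists_transferKernel_le su2Rep continuous_su2Rep β (L := L)
  have hCW0 : 0 ≤ CW := (abs_nonneg _).trans (hCW 1)
  have hM0 : 0 ≤ M := (transferKernel_pos su2Rep β (1 : GaugeConfig 3 L SU2) 1).le.trans (hM 1 1)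
  refine ⟨CW * M * CΩ, fun _ => ?_⟩
  rw [abs_mul, abs_mul, abs_of_pos (transferKernel_pos su2Rep β _ _)]
  exact mul_le_mul (mul_le_mul (hCW _) (hM _ _) (transferKernel_pos su2Rep β _ _).le hCW0) (hCΩ _) (abs_nonneg _) (mul_nonneg hCW0 hM0)

/-- `fpFibreTransfer ≥ 0` for `Ω, W ≥ 0`. [folklore] -/
theorem fpFibreTransfer_nonneg (β : ℝ) {Ω : LinkSpace L → ℝ} (hΩ0 : ∀ x, 0 ≤ Ω x) {W : (Site 3 L → SU2) → ℝ} (hW0 : ∀ g, 0 ≤ W g) (U : GaugeConfig 3 L SU2)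
    (u : GaugeConfig 3 1 SU2) : 0 ≤ fpFibreTransfer L β Ω W U u :=
  integral_nonneg fun _ => mul_nonneg (mul_nonneg (hW0 _) (transferKernel_pos su2Rep β _ _).le) (hΩ0 _)

/-! ## §3 ★★★ Two-sided transport of the fibre transfer to the central fibre -/

/-- ★★★ **TWO-SIDED TRANSPORT.**  Fix the output tube point `oT u' v'` and the input slow point `u`.  If the transport exponent is small on the supports —
`|offX β u' u v' v g + diagX β u' v' v g| ≤ η` whenever `Ω(v̂) ≠ 0` and `W g ≠ 0` — and `Ω, W ≥ 0`, then with `ρ = K₁^{(L³β)}(u',u)/K₁^{(L³β)}(1,1)` and the central transfer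
`T₁ = fpFibreTransfer β Ω W (oT 1 v') 1`:  `e^{−η}·ρ·T₁ ≤ fpFibreTransfer β Ω W (oT u' v') u ≤ e^{η}·ρ·T₁`. [cite: Luscher1983, §3] -/
theorem fpFibreTransfer_two_sided (β : ℝ) {Ω : LinkSpace L → ℝ} (hΩm : Measurable Ω) {CΩ : ℝ} (hCΩ : ∀ x, |Ω x| ≤ CΩ) (hΩ0 : ∀ x, 0 ≤ Ω x)
    {W : (Site 3 L → SU2) → ℝ} (hW : Measurable W) {CW : ℝ} (hCW : ∀ g, |W g| ≤ CW) (hW0 : ∀ g, 0 ≤ W g) (u u' : GaugeConfig 3 1 SU2) (v' : Edge 3 L → Fin 3 → ℝ)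
    {η : ℝ} (hX : ∀ (v : Edge 3 L → Fin 3 → ℝ) (g : Site 3 L → SU2), Ω (linkEmbed L v) ≠ 0 → W g ≠ 0 → |offX L β u' u v' v g + diagX L β u' v' v g| ≤ η) :
    Real.exp (-η) * (transferKernel su2Rep ((L : ℝ) ^ 3 * β) u' u / transferKernel su2Rep ((L : ℝ) ^ 3 * β) (1 : GaugeConfig 3 1 SU2) 1) *
        fpFibreTransfer L β Ω W (orthoTube L 1 v') 1 ≤ fpFibreTransfer L β Ω W (orthoTube L u' v') u ∧
      fpFibreTransfer L β Ω W (orthoTube L u' v') u ≤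
        Real.exp η * (transferKernel su2Rep ((L : ℝ) ^ 3 * β) u' u / transferKernel su2Rep ((L : ℝ) ^ 3 * β) (1 : GaugeConfig 3 1 SU2) 1) *
          fpFibreTransfer L β Ω W (orthoTube L 1 v') 1 := by
  haveI := isFiniteMeasure_orthoTransverse L
  set μP : Measure ((Edge 3 L → Fin 3 → ℝ) × (Site 3 L → SU2)) := (orthoTransverse L).prod (gaugeMeasure L) with hμP
  set ρ : ℝ := transferKernel su2Rep ((L : ℝ) ^ 3 * β) u' u / transferKernel su2Rep ((L : ℝ) ^ 3 * β) (1 : GaugeConfig 3 1 SU2) 1 with hρ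
  have hρ0 : 0 < ρ := div_pos (transferKernel_pos _ _ _ _) (transferKernel_pos _ _ _ _)
  -- the two integrands
  set I : (Edge 3 L → Fin 3 → ℝ) × (Site 3 L → SU2) → ℝ := fun p =>
    W p.2 * transferKernel su2Rep β (orthoTube L u' v') (gaugeTransform p.2 (orthoTube L u p.1)) * Ω (linkEmbed L p.1) with hI
  set J : (Edge 3 L → Fin 3 → ℝ) × (Site 3 L → SU2) → ℝ := fun p =>
    W p.2 * transferKernel su2Rep β (orthoTube L 1 v') (gaugeTransform p.2 (orthoTube L 1 p.1)) * Ω (linkEmbed L p.1) with hJ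
  obtain ⟨BI, hBI⟩ := abs_fpFibreTransfer_integrand_le (L := L) β hCΩ hCW (orthoTube L u' v') u
  obtain ⟨BJ, hBJ⟩ := abs_fpFibreTransfer_integrand_le (L := L) β hCΩ hCW (orthoTube L 1 v') 1
  have hIint : Integrable I μP := integrable_of_measurable_abs_le μP (measurable_fpFibreTransfer_integrand β hΩm hW _ _) hBI
  have hJint : Integrable J μP := integrable_of_measurable_abs_le μP (measurable_fpFibreTransfer_integrand β hΩm hW _ _) hBJ
  have hJ0 : ∀ p, 0 ≤ J p := fun p => mul_nonneg (mul_nonneg (hW0 _) (transferKernel_pos su2Rep β _ _).le) (hΩ0 _)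
  -- pointwise: `I = ρ·J·e^{X}` and the sandwich
  have hpt : ∀ p, I p = ρ * J p * Real.exp (offX L β u' u v' p.1 p.2 + diagX L β u' v' p.1 p.2) := fun p => by
    rw [hI, hJ]; dsimp only
    rw [transferKernel_orthoTube_transport (L := L) β u' u v' p.1 p.2, hρ]; ring
  have hbounds : ∀ p, Real.exp (-η) * ρ * J p ≤ I p ∧ I p ≤ Real.exp η * ρ * J p := fun p => by
    rw [hpt p]
    by_cases h0 : J p = 0
    · rw [h0]; simp
    · have hWg : W p.2 ≠ 0 := by intro hz; apply h0; rw [hJ]; dsimp only; rw [hz, zero_mul, zero_mul]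
      have hΩv : Ω (linkEmbed L p.1) ≠ 0 := by intro hz; apply h0; rw [hJ]; dsimp only; rw [hz, mul_zero]
      have hx := abs_le.mp (hX p.1 p.2 hΩv hWg)
      have hJp : 0 ≤ ρ * J p := mul_nonneg hρ0.le (hJ0 p)
      constructor
      · calc Real.exp (-η) * ρ * J p = ρ * J p * Real.exp (-η) := by ring
          _ ≤ ρ * J p * Real.exp (offX L β u' u v' p.1 p.2 + diagX L β u' v' p.1 p.2) :=
              mul_le_mul_of_nonneg_left (Real.exp_le_exp.mpr hx.1) hJp
      · calc ρ * J p * Real.exp (offX L β u' u v' p.1 p.2 + diagX L β u' v' p.1 p.2) ≤ ρ * J p * Real.exp η :=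
              mul_le_mul_of_nonneg_left (Real.exp_le_exp.mpr hx.2) hJp
          _ = Real.exp η * ρ * J p := by ring
  have hT : fpFibreTransfer L β Ω W (orthoTube L u' v') u = ∫ p, I p ∂μP := rfl
  have hT1 : fpFibreTransfer L β Ω W (orthoTube L 1 v') 1 = ∫ p, J p ∂μP := rfl
  rw [hT, hT1]
  constructor
  · calc Real.exp (-η) * ρ * ∫ p, J p ∂μP = ∫ p, Real.exp (-η) * ρ * J p ∂μP := by rw [← integral_const_mul]
      _ ≤ ∫ p, I p ∂μP := integral_mono (hJint.const_mul _) hIint fun p => (hbounds p).1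
  · calc ∫ p, I p ∂μP ≤ ∫ p, Real.exp η * ρ * J p ∂μP := integral_mono hIint (hJint.const_mul _) fun p => (hbounds p).2
      _ = Real.exp η * ρ * ∫ p, J p ∂μP := by rw [← integral_const_mul]

end Summit.QuantumFields.YangMills.Theorems.FemtoTransferGap.TwoLattice.ConstTube

end
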